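import Mathlib
import HarnessLib
import Summits.HubbardSuperconductivity.HubbardSuperconductivity.Theorems.KLProgrammeKLRegimeVolumeLimitLastScaleCommonFrameDoor
import Summits.HubbardSuperconductivity.HubbardSuperconductivity.Theorems.KLProgrammeKLRegimeTwoVolumeDualDefectPinned
import Summits.HubbardSuperconductivity.HubbardSuperconductivity.Theses.KLProgramme

/-!
# Route `KLProgramme` — crux K3, VL child `KLRegimeVolumeLimitV17F2` (stmt-HubbardSuperconductivity-20440): THE REGISTERED STUB TEXT FROM THE
# COMMON-FRAME PINNED position-space two-leg defect ALONE — the most primitive target of ROUTE A's (A3) when both towers run at the coarse frame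
# (cell gate-hubbard-kl, seat hubbard-kl-k3c5-p3 g9, technique «OS-positivity-free direct assembly»)

k3c4-p2 g9's `…LastScaleCommonFrameDoor.framedNestedFlowTextV17F2_of_commonFrame_bounded` (stub ⟸ unit + common-frame comparison + one-volume bound; leg (ii) =
exact last-scale algebra) ∘ this seat's dual read-out `norm_klSelfEnergy_sub_le_frame_add_dualDefect` (at `Kc = Kf = K_L`: frame term `≡ 0`) ∘ `…TwoVolumeDualDefectPinned`
(rows ≤ plain pinned kernels: phases dropped, times summed, `dualRows_le_pinnedDefect`, `norm_phaseRow_le`); route-cone note: this leaf imports the route file only for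
its closer and builds on NO Theses-importing Theorems module (twin of `…LastScaleCommonFrameDualExact`, which states the ROW form).  With `W_V := sectorisedKernel V M β (trivialMultiplier V M)
(klEffectiveAction V M β U μ K_L klE0 (n_β+1) − counterQuadratic V M β K_L) 2 ((0,0,+),(0,0,−))` — BOTH volumes at the coarse frame `K_L = klFlowFrameU L M β U μ (n_β+1)`:

* **`framedNestedFlowTextV17F2_of_commonFramePinnedDefect`** — stub text ⟸ «per Matsubara integer ∃ L₀ δ→0 B: for L ≥ L₀, L″ = b·L, eventually in M, ∃ pins o_c, o_f
  with a common time coordinate, at every label of that integer: IsUnit Z_{L″}^{n⋆}(K_L) ∧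
  2ε·(Σ_{t₁,x̄}‖W_L(o_c,(t₁,o⃗_c+x̄)) − W_{L″}(o_f,(t₁,o⃗_f+x̄↑))‖ + Σ_{t₁, y ≠ (red y)↑}‖W_{L″}(o_f,(t₁,o⃗_f+y))‖) ≤ δ L ∧ 2ε·Σ_{t₁,y}‖W_L(o_c,(t₁,o⃗_c+y))‖ ≤ B»;
* `volumeLimitTextV17F2_of_commonFramePinnedDefect` and the by-workitem closer **`KLRegimeVolumeLimitV17F2_of_commonFramePinnedDefect`**.

Proofs only; no definition.  References: BGM 2006 §2.4 (2.38).
-/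

noncomputable section

namespace Summit.HubbardSuperconductivity.HubbardSuperconductivity.Theorems.TwoPointAssembly

set_option linter.dupNamespace false -- summit = problem name (single-conjunct summit), D-0017

open Finset Filter Topology Complex Literature.MathematicalPhysics.QuantumLattice Literature.Probability.LatticeModels GrassmannAlgebra
open Summit.HubbardSuperconductivity.HubbardSuperconductivity.Theorems.KLRegimeSplit
open Summit.HubbardSuperconductivity.HubbardSuperconductivity.Theorems.KLProgrammeLegKernels
open Summit.HubbardSuperconductivity.HubbardSuperconductivity.Theorems.TwoVolumeDefect

/-- **THE STUB TEXT FROM THE COMMON-FRAME PINNED TWO-LEG DEFECT ALONE.**  See the module docstring. [cite: BenfattoGiulianiMastropietro2006, §2.4 (2.38)] -/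
theorem framedNestedFlowTextV17F2_of_commonFramePinnedDefect
    (hD : ∀ (G : GeoConsts) (P : SplitConsts) (Q : EngConsts) (R : RenConsts), G.WF → P.WF → Q.WF → R.WF →
      ∃ c₅ : ℝ, 0 < c₅ ∧ ∀ c : ℝ, 0 < c → c ≤ c₅ → ∃ U₀ : ℝ, 0 < U₀ ∧
        ∀ μ ∈ klWindowC, ∀ U : ℝ, 0 < U → U ≤ U₀ → ∀ β : ℝ, klBetaMin ≤ β → β ≤ Real.exp (c / U ^ 2) →
          ∀ K : TrigPolyC4v, klPredsV17F2.frameOK R U (nScales β) μ K →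
            ∀ (Lstar : ℕ) (Mstar : ℕ → ℕ), TowerP klPredsV17F2 G P Q R β U μ K Lstar Mstar →
              ∀ n : ℤ, ∃ L₀ : ℕ, ∃ δ : ℕ → ℝ, ∃ B : ℝ, Tendsto δ atTop (𝓝 0) ∧
                ∀ (L : ℕ) [NeZero L], L₀ ≤ L → ∀ (L'' : ℕ) [NeZero L''] (b : ℕ), L'' = b * L → ∃ M₀ : ℕ, ∀ (M : ℕ) [NeZero M], M₀ ≤ M →
                  ∃ (oc : SpaceTimeIdx L M) (of : SpaceTimeIdx L'' M), of.1 = oc.1 ∧ ∀ ω : MatsubaraIdx M, matsubaraInt M ω = n →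
                    IsUnit (effPartitionFn ℂ
                        (normalCovariance L'' M (uvSymbolCT L'' M β μ (klFlowFrameU L M β U μ (nScales β + 1)) (klScale klE0 (nScales β + 1))))
                        (hubbardInteraction L'' M β U + counterQuadratic L'' M β (klFlowFrameU L M β U μ (nScales β + 1)))) ∧
                    2 * imagTimeWeight β M *
                      ((∑ t₁ : ImagTimeIdx M, ∑ ybar : TorusSite 2 L,
                          ‖sectorisedKernel L M β (trivialMultiplier L M)
                                (klEffectiveAction L M β U μ (klFlowFrameU L M β U μ (nScales β + 1)) klE0 (nScales β + 1) -
                                  counterQuadratic L M β (klFlowFrameU L M β U μ (nScales β + 1))) 2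
                                (![((0, 0), 0), ((0, 0), 1)] : Fin 2 → SectorLeg 1) ![oc, (t₁, oc.2 + ybar)] -
                            sectorisedKernel L'' M β (trivialMultiplier L'' M)
                                (klEffectiveAction L'' M β U μ (klFlowFrameU L M β U μ (nScales β + 1)) klE0 (nScales β + 1) -
                                  counterQuadratic L'' M β (klFlowFrameU L M β U μ (nScales β + 1))) 2
                                (![((0, 0), 0), ((0, 0), 1)] : Fin 2 → SectorLeg 1) ![of, (t₁, of.2 + Torus.proj L'' (Torus.cRep ybar))]‖) +
                        ∑ t₁ : ImagTimeIdx M,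
                          ∑ y ∈ univ.filter (fun y : TorusSite 2 L'' => Torus.proj L'' (Torus.cRep (fun i => (((y i).val : ℕ) : ZMod L))) ≠ y),
                            ‖sectorisedKernel L'' M β (trivialMultiplier L'' M)
                                (klEffectiveAction L'' M β U μ (klFlowFrameU L M β U μ (nScales β + 1)) klE0 (nScales β + 1) -
                                  counterQuadratic L'' M β (klFlowFrameU L M β U μ (nScales β + 1))) 2
                                (![((0, 0), 0), ((0, 0), 1)] : Fin 2 → SectorLeg 1) ![of, (t₁, of.2 + y)]‖) ≤ δ L ∧
                    2 * imagTimeWeight β M *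
                      ∑ t₁ : ImagTimeIdx M, ∑ y : TorusSite 2 L,
                        ‖sectorisedKernel L M β (trivialMultiplier L M)
                            (klEffectiveAction L M β U μ (klFlowFrameU L M β U μ (nScales β + 1)) klE0 (nScales β + 1) -
                              counterQuadratic L M β (klFlowFrameU L M β U μ (nScales β + 1))) 2
                            (![((0, 0), 0), ((0, 0), 1)] : Fin 2 → SectorLeg 1) ![oc, (t₁, oc.2 + y)]‖ ≤ B) :
    ∀ (G : GeoConsts) (P : SplitConsts) (Q : EngConsts) (R : RenConsts), G.WF → P.WF → Q.WF → R.WF →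
      ∃ c₅ : ℝ, 0 < c₅ ∧ ∀ c : ℝ, 0 < c → c ≤ c₅ → ∃ U₀ : ℝ, 0 < U₀ ∧
        ∀ μ ∈ klWindowC, ∀ U : ℝ, 0 < U → U ≤ U₀ → ∀ β : ℝ, klBetaMin ≤ β → β ≤ Real.exp (c / U ^ 2) →
          ∀ K : TrigPolyC4v, klPredsV17F2.frameOK R U (nScales β) μ K →
            ∀ (Lstar : ℕ) (Mstar : ℕ → ℕ), TowerP klPredsV17F2 G P Q R β U μ K Lstar Mstar →
              ∀ n : ℤ, ∃ L₀ : ℕ, ∃ ρ : ℕ → ℝ, Tendsto ρ atTop (𝓝 0) ∧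
                ∀ (L : ℕ) [NeZero L], L₀ ≤ L → ∀ (L'' : ℕ) [NeZero L''], L ∣ L'' → ∃ M₀ : ℕ, ∀ (M : ℕ) [NeZero M], M₀ ≤ M →
                  ∀ (ω : MatsubaraIdx M), matsubaraInt M ω = n → ∀ (k : TorusSite 2 L) (k'' : TorusSite 2 L''),
                    latticeMomentum L'' k'' = latticeMomentum L k →
                      ‖klSelfEnergy L M β U μ (klFlowFrameU L M β U μ (nScales β + 1)) klE0 (nScales β + 1) (ω, k) 0 -
                          klSelfEnergy L'' M β U μ (klFlowFrameU L'' M β U μ (nScales β + 1)) klE0 (nScales β + 1) (ω, k'') 0‖ ≤ ρ L := by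
  refine framedNestedFlowTextV17F2_of_commonFrame_bounded ?_
  intro G P Q R hG hP hQ hR
  obtain ⟨c₅, hc₅, hc⟩ := hD G P Q R hG hP hQ hR
  refine ⟨c₅, hc₅, fun c hc0 hcc => ?_⟩
  obtain ⟨U₀, hU₀, hU⟩ := hc c hc0 hcc
  refine ⟨U₀, hU₀, fun μ hμ U hU0 hUU β hβmin hβmax K hK Lstar Mstar hT n => ?_⟩
  have hβ : 0 < β := pos_of_klBetaMin_le hβmin
  obtain ⟨L₀, δ, B, hδ, hDn⟩ := hU μ hμ U hU0 hUU β hβmin hβmax K hK Lstar Mstar hT n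
  -- the frame sup bound from the tower
  set Kmax : ℝ := ∑ m ∈ range (nScales β + 1), R.Gfr 0 * uPow 0 U * (4 : ℝ) ^ ((((0 : ℕ) : ℤ) - 2) * (m : ℤ)) with hKmax
  refine ⟨max L₀ Lstar, δ, Kmax + B, hδ, fun L _ hL L'' _ hdvd => ?_⟩
  obtain ⟨b, hb⟩ := hdvd
  have hb' : L'' = b * L := by rw [hb, mul_comm]
  have hL₀ : L₀ ≤ L := (le_max_left _ _).trans hL
  have hLs : Lstar ≤ L := (le_max_right _ _).trans hL
  obtain ⟨M₀, hM₀⟩ := hDn L hL₀ L'' b hb'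
  refine ⟨max M₀ (Mstar L), fun M _ hM ω hω k k'' hk => ?_⟩
  have hMM₀ : M₀ ≤ M := (le_max_left _ _).trans hM
  have hM₁ : Mstar L ≤ M := (le_max_right _ _).trans hM
  obtain ⟨oc, of, ht, hw⟩ := hM₀ M hMM₀
  obtain ⟨hZ, hdef, hB⟩ := hw ω hω
  have hε : 0 ≤ 2 * imagTimeWeight β M := by have := imagTimeWeight_nonneg hβ.le M; positivity
  refine ⟨hZ, ?_, ?_⟩
  · -- leg (i): common-frame dual read-out (frame term vanishes), rows ≤ pinned kernels
    have hi := norm_klSelfEnergy_sub_le_frame_add_dualDefect hb' hβ U μ (klFlowFrameU L M β U μ (nScales β + 1))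
      (klFlowFrameU L M β U μ (nScales β + 1)) (nScales β + 1) ω 0 oc of hk
    rw [sub_self, abs_zero, zero_add] at hi
    exact hi.trans ((mul_le_mul_of_nonneg_left (dualRows_le_pinnedDefect _ _ β ω oc of ht) hε).trans hdef)
  · -- the one-volume bound: `Σ[𝒱[K]] = K(p) + Σ[𝒱[K] − 𝒩_K]`, `|K(p)| ≤ Kmax`, rows ≤ pinned kernels
    rw [klSelfEnergy_eq_eval_add_selfEnergy_sub_counter hβ.ne' U μ _ (nScales β + 1) (ω, k) 0]
    refine (norm_add_le _ _).trans (add_le_add ?_ ?_)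
    · rw [Complex.norm_real, Real.norm_eq_abs]
      exact abs_eval_klFlowFrameU_le_of_towerV17F2 hT hLs hM₁ le_rfl _
    · refine (norm_selfEnergy_le_dualRows hβ _ ω 0 (rows_baseIndependent_klEffectiveAction_sub_counter hβ.ne' U μ _ _ ω 0) oc k).trans ?_
      refine le_trans (mul_le_mul_of_nonneg_left ?_ hε) hB
      rw [sum_comm]
      exact sum_le_sum fun y _ => norm_phaseRow_le _ β ω oc _

/-- **The VL child text from the common-frame pinned two-leg defect alone.** [cite: BenfattoGiulianiMastropietro2006, §2.4 (2.38)] -/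
theorem volumeLimitTextV17F2_of_commonFramePinnedDefect
    (hD : ∀ (G : GeoConsts) (P : SplitConsts) (Q : EngConsts) (R : RenConsts), G.WF → P.WF → Q.WF → R.WF →
      ∃ c₅ : ℝ, 0 < c₅ ∧ ∀ c : ℝ, 0 < c → c ≤ c₅ → ∃ U₀ : ℝ, 0 < U₀ ∧
        ∀ μ ∈ klWindowC, ∀ U : ℝ, 0 < U → U ≤ U₀ → ∀ β : ℝ, klBetaMin ≤ β → β ≤ Real.exp (c / U ^ 2) →
          ∀ K : TrigPolyC4v, klPredsV17F2.frameOK R U (nScales β) μ K →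
            ∀ (Lstar : ℕ) (Mstar : ℕ → ℕ), TowerP klPredsV17F2 G P Q R β U μ K Lstar Mstar →
              ∀ n : ℤ, ∃ L₀ : ℕ, ∃ δ : ℕ → ℝ, ∃ B : ℝ, Tendsto δ atTop (𝓝 0) ∧
                ∀ (L : ℕ) [NeZero L], L₀ ≤ L → ∀ (L'' : ℕ) [NeZero L''] (b : ℕ), L'' = b * L → ∃ M₀ : ℕ, ∀ (M : ℕ) [NeZero M], M₀ ≤ M →
                  ∃ (oc : SpaceTimeIdx L M) (of : SpaceTimeIdx L'' M), of.1 = oc.1 ∧ ∀ ω : MatsubaraIdx M, matsubaraInt M ω = n →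
                    IsUnit (effPartitionFn ℂ
                        (normalCovariance L'' M (uvSymbolCT L'' M β μ (klFlowFrameU L M β U μ (nScales β + 1)) (klScale klE0 (nScales β + 1))))
                        (hubbardInteraction L'' M β U + counterQuadratic L'' M β (klFlowFrameU L M β U μ (nScales β + 1)))) ∧
                    2 * imagTimeWeight β M *
                      ((∑ t₁ : ImagTimeIdx M, ∑ ybar : TorusSite 2 L,
                          ‖sectorisedKernel L M β (trivialMultiplier L M)
                                (klEffectiveAction L M β U μ (klFlowFrameU L M β U μ (nScales β + 1)) klE0 (nScales β + 1) -
                                  counterQuadratic L M β (klFlowFrameU L M β U μ (nScales β + 1))) 2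
                                (![((0, 0), 0), ((0, 0), 1)] : Fin 2 → SectorLeg 1) ![oc, (t₁, oc.2 + ybar)] -
                            sectorisedKernel L'' M β (trivialMultiplier L'' M)
                                (klEffectiveAction L'' M β U μ (klFlowFrameU L M β U μ (nScales β + 1)) klE0 (nScales β + 1) -
                                  counterQuadratic L'' M β (klFlowFrameU L M β U μ (nScales β + 1))) 2
                                (![((0, 0), 0), ((0, 0), 1)] : Fin 2 → SectorLeg 1) ![of, (t₁, of.2 + Torus.proj L'' (Torus.cRep ybar))]‖) +
                        ∑ t₁ : ImagTimeIdx M,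
                          ∑ y ∈ univ.filter (fun y : TorusSite 2 L'' => Torus.proj L'' (Torus.cRep (fun i => (((y i).val : ℕ) : ZMod L))) ≠ y),
                            ‖sectorisedKernel L'' M β (trivialMultiplier L'' M)
                                (klEffectiveAction L'' M β U μ (klFlowFrameU L M β U μ (nScales β + 1)) klE0 (nScales β + 1) -
                                  counterQuadratic L'' M β (klFlowFrameU L M β U μ (nScales β + 1))) 2
                                (![((0, 0), 0), ((0, 0), 1)] : Fin 2 → SectorLeg 1) ![of, (t₁, of.2 + y)]‖) ≤ δ L ∧
                    2 * imagTimeWeight β M *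
                      ∑ t₁ : ImagTimeIdx M, ∑ y : TorusSite 2 L,
                        ‖sectorisedKernel L M β (trivialMultiplier L M)
                            (klEffectiveAction L M β U μ (klFlowFrameU L M β U μ (nScales β + 1)) klE0 (nScales β + 1) -
                              counterQuadratic L M β (klFlowFrameU L M β U μ (nScales β + 1))) 2
                            (![((0, 0), 0), ((0, 0), 1)] : Fin 2 → SectorLeg 1) ![oc, (t₁, oc.2 + y)]‖ ≤ B) :
    VolumeLimitP2 klPredsV17F2 FinalTwoLegVolLimitEx klWindowC :=
  volumeLimitTextV17F2_of_framedNestedFlowText (framedNestedFlowTextV17F2_of_commonFramePinnedDefect hD)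

/-- **The rev-22 VL child `KLRegimeVolumeLimitV17F2` (stmt-…-20440) from the common-frame pinned two-leg defect alone** (by-`--workitem` closer).
[cite: BenfattoGiulianiMastropietro2006, §2.4 (2.38)] -/
theorem KLRegimeVolumeLimitV17F2_of_commonFramePinnedDefect
    (hD : ∀ (G : GeoConsts) (P : SplitConsts) (Q : EngConsts) (R : RenConsts), G.WF → P.WF → Q.WF → R.WF →
      ∃ c₅ : ℝ, 0 < c₅ ∧ ∀ c : ℝ, 0 < c → c ≤ c₅ → ∃ U₀ : ℝ, 0 < U₀ ∧
        ∀ μ ∈ klWindowC, ∀ U : ℝ, 0 < U → U ≤ U₀ → ∀ β : ℝ, klBetaMin ≤ β → β ≤ Real.exp (c / U ^ 2) →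
          ∀ K : TrigPolyC4v, klPredsV17F2.frameOK R U (nScales β) μ K →
            ∀ (Lstar : ℕ) (Mstar : ℕ → ℕ), TowerP klPredsV17F2 G P Q R β U μ K Lstar Mstar →
              ∀ n : ℤ, ∃ L₀ : ℕ, ∃ δ : ℕ → ℝ, ∃ B : ℝ, Tendsto δ atTop (𝓝 0) ∧
                ∀ (L : ℕ) [NeZero L], L₀ ≤ L → ∀ (L'' : ℕ) [NeZero L''] (b : ℕ), L'' = b * L → ∃ M₀ : ℕ, ∀ (M : ℕ) [NeZero M], M₀ ≤ M →
                  ∃ (oc : SpaceTimeIdx L M) (of : SpaceTimeIdx L'' M), of.1 = oc.1 ∧ ∀ ω : MatsubaraIdx M, matsubaraInt M ω = n →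
                    IsUnit (effPartitionFn ℂ
                        (normalCovariance L'' M (uvSymbolCT L'' M β μ (klFlowFrameU L M β U μ (nScales β + 1)) (klScale klE0 (nScales β + 1))))
                        (hubbardInteraction L'' M β U + counterQuadratic L'' M β (klFlowFrameU L M β U μ (nScales β + 1)))) ∧
                    2 * imagTimeWeight β M *
                      ((∑ t₁ : ImagTimeIdx M, ∑ ybar : TorusSite 2 L,
                          ‖sectorisedKernel L M β (trivialMultiplier L M)
                                (klEffectiveAction L M β U μ (klFlowFrameU L M β U μ (nScales β + 1)) klE0 (nScales β + 1) -
                                  counterQuadratic L M β (klFlowFrameU L M β U μ (nScales β + 1))) 2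
                                (![((0, 0), 0), ((0, 0), 1)] : Fin 2 → SectorLeg 1) ![oc, (t₁, oc.2 + ybar)] -
                            sectorisedKernel L'' M β (trivialMultiplier L'' M)
                                (klEffectiveAction L'' M β U μ (klFlowFrameU L M β U μ (nScales β + 1)) klE0 (nScales β + 1) -
                                  counterQuadratic L'' M β (klFlowFrameU L M β U μ (nScales β + 1))) 2
                                (![((0, 0), 0), ((0, 0), 1)] : Fin 2 → SectorLeg 1) ![of, (t₁, of.2 + Torus.proj L'' (Torus.cRep ybar))]‖) +
                        ∑ t₁ : ImagTimeIdx M,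
                          ∑ y ∈ univ.filter (fun y : TorusSite 2 L'' => Torus.proj L'' (Torus.cRep (fun i => (((y i).val : ℕ) : ZMod L))) ≠ y),
                            ‖sectorisedKernel L'' M β (trivialMultiplier L'' M)
                                (klEffectiveAction L'' M β U μ (klFlowFrameU L M β U μ (nScales β + 1)) klE0 (nScales β + 1) -
                                  counterQuadratic L'' M β (klFlowFrameU L M β U μ (nScales β + 1))) 2
                                (![((0, 0), 0), ((0, 0), 1)] : Fin 2 → SectorLeg 1) ![of, (t₁, of.2 + y)]‖) ≤ δ L ∧
                    2 * imagTimeWeight β M *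
                      ∑ t₁ : ImagTimeIdx M, ∑ y : TorusSite 2 L,
                        ‖sectorisedKernel L M β (trivialMultiplier L M)
                            (klEffectiveAction L M β U μ (klFlowFrameU L M β U μ (nScales β + 1)) klE0 (nScales β + 1) -
                              counterQuadratic L M β (klFlowFrameU L M β U μ (nScales β + 1))) 2
                            (![((0, 0), 0), ((0, 0), 1)] : Fin 2 → SectorLeg 1) ![oc, (t₁, oc.2 + y)]‖ ≤ B) :
    Summit.HubbardSuperconductivity.HubbardSuperconductivity.Theses.KLProgramme.KLRegimeVolumeLimitV17F2 := by
  show VolumeLimitP2 klPredsV17F2 FinalTwoLegVolLimitEx klWindowC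
  exact volumeLimitTextV17F2_of_commonFramePinnedDefect hD

end Summit.HubbardSuperconductivity.HubbardSuperconductivity.Theorems.TwoPointAssembly
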